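import Summits.QuantumFields.BalabanUV.T4Continuum.Support.NE7SliceFrameMatchingLimit
import Summits.QuantumFields.BalabanUV.T4Continuum.Support.NE7AccumulatedFrameLinearisation
import HarnessLib

/-!
# NE7SliceNonlinearFrameDefect — THE (1.37)-DEFECT OF THE (S1) REPRESENTATIVE IS QUADRATIC: at a state `u` of the working region whose LINEAR frames are matched
# (`framePotW L (k+1) W T(u) = h(u)`, true at the (S1) limit by `NE7SliceFrameMatchingLimit.frameMismatch_limit_eq_zero`), the NONLINEAR accumulated frame of the chart field,
# `v_{k+1} = vcov L W (relPert W X(u)) (k+1)` ([Balaban1985Averaging] (97)), misses the corner logs only at second order: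
# `‖mlog v_{k+1}(z) − h(u)(z)‖ ≤ C_Γ·(M·b)² + 6dM·sup‖N(u)‖` (`M = L^{k+1}`, `sup‖X(u)‖ ≤ b`, `N(u)` the normal part) — named ask [NE7P1-G102-ASK-3], answer (c)

Cell `pub-balaban`, rung (B)+1 sub-cell t4, lineage `b2b-balaban-t4-ne7b-p1`, generation 151 (OWNER of BINDER row NE7b; junction service for the NE crew, ruling R-OWNER-149-1 (2)).
A JUNCTION for row NE7 (node U5).  The road (t4-ne7-p1 g102, ROAD-G102 §11 ∕ `HOME/INBOX.md` L.2625) asks whether the frame matching of the (S1) representative can be had with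
the NONLINEAR target `v_{k+1}(relPert W X⋆) = e^{h⋆}` (⟺ [B8] (1.37), `Spine/NE3/PairFrameCondition.dbar_of_frame_eq`).  Not by continuity: the (S1) defect measures the LINEAR
frames (`NE7SliceIterationState.IsNormalisedSplit`, `frameMismatch`, `sliceDefect`), and `v` differs from `exp ∘ framePotW` at second order.  THIS FILE quantifies the gap with tree letters
BY NAME: `NE7AccumulatedFrameLinearisation.norm_mlog_vcov_sub_framePotW_le` (t4-ne7-p1 gen 97: `‖mlog v_k(z) − framePotW L k W X z‖ ≤ (56(dL)² + 16C₁dL)(L^k b)²`, Prop-4 regime,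
k-free), `NE7SliceFrameMatchingLimit.framePotW_sub` (`T = X − N` pointwise ⟹ `framePotW T = framePotW X − framePotW N`), `NE3LinearisedAverageSup.norm_framePotW_le_sup`
(`‖framePotW N z‖ ≤ 6dM·sup‖N‖`), the hypothesis `framePotW T(u) = h(u)`.  The three-term identity
`mlog v − h = (mlog v − framePotW X) + framePotW N + (framePotW T − h)` then gives the letter; at the limit `u⋆` the last term is ZERO by gen 151's theorem.
WHAT ([folklore]; 0 def, 0 sorry; hypotheses displayed in BOTH vocabularies — the (S1) class `LevelSmall ∕ SmallField ∕ cruxC ∕ curvSum` and B7's Prop-4 regime at level `k+1`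
(`pdev W < α₀·M⁻²`, `100·dL·Mb ≤ 1`, …) — no bridge between them is asserted).
§1 **`norm_mlog_vcov_sub_cornerLog_le`** (any state `u` with matched linear frames; sizes `sup‖X(u)‖ ≤ b`, `sup‖N(u)‖ ≤ sN` displayed).
§2 **`norm_mlog_vcov_sub_cornerLog_limit_le`** (at the sitewise limit `u⋆` of an (S1) orbit, in the one-call binder shape of `frameMismatch_limit_eq_zero` ∕
   `tangentPart_limit_mem_of_geometric`: the hypothesis `framePotW T(u⋆) = h(u⋆)` is discharged by `frameMismatch_limit_eq_zero`).
HONEST FRAMING (page 1): bookkeeping by name; the letter says the (1.37)-defect of the representative is QUADRATIC — it does NOT deliver (1.37) (that needs the road's (R1) re-posed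
iteration or (R2) corner normalisation, journal [NE7bP1-G151-FINDING-2]); nothing of Bałaban's asserted; NOT (S2), NOT NE7, nothing of row NE7b; spine 0∕9; finite T⁴ rung (B)+1 —
NOT infinite volume, NOT mass gap, NOT BetaPertH, NOT Clay.  Continuum YM on T⁴ ⇐ BetaPertH ∧ nine spine estimates (0/9 proved); BetaPertH ⇐ (D1) ∧ (D4) ∧ CAP+tail; G-an2-4 gates
asym, D1 and NE2/3/4.
-/

set_option autoImplicit false

open scoped BigOperators Matrix Matrix.Norms.L2Operator Topology
open NormedSpace Finset Filter

namespace Summit.QuantumFields.BalabanUV.T4Continuum.NE7SliceNonlinearFrameDefect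

open Literature.MathematicalPhysics.QuantumFieldTheory.Balaban1983to89
open B7Prop1Explicit B7Prop2Explicit B7Prop3Flat MatrixLog
open B7Eq92Concrete (vcov)
open T4AveragingDeficitWall (IsUnitaryCfg SmallField vary)
open T4AveragingDeficitWallBoundary (IsPeriodicCfg)
open AveragingDeficitMultiLevelPrep (LevelSmall tower)
open NE3EnergyShapes (IsUnitarySite IsPeriodicSite)
open NE3TangentCovariantTower (framePotW)
open NE3QbarIterCovLiftPrep (cruxC)
open NE3LinearisedAverageSup (norm_framePotW_le_sup curvSum)
open NE3.PairLandauB8Avg (relPert)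
open NE7SliceIterationState (repLog cornerLog normalPart tangentPart sliceDefect)
open NE7SliceFrameMatchingLimit (framePotW_sub frameMismatch_limit_eq_zero)
open NE7AccumulatedFrameLinearisation (norm_mlog_vcov_sub_framePotW_le)

noncomputable section

variable {d : ℕ} {n : Type*} [Fintype n] [DecidableEq n] [Nonempty n]

/-! ## §1 The letter at a state with matched linear frames -/

section State

variable {L : ℕ} (hL : 2 ≤ L) (k : ℕ) {W : Site d → Fin d → (Matrix n n ℂ)ˣ} {x : ℝ} (hWu : IsUnitaryCfg W) (hx : 0 ≤ x) (hs : LevelSmall d L k x)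
  (hWx : SmallField W x) (N : ℕ) [NeZero N] (hθ : cruxC d L * (((L : ℝ) ^ (k + 1)) ^ 2 * x) < 1) (U' : Site d → Fin d → (Matrix n n ℂ)ˣ)
  (hA : curvSum d L (k + 1) x ≤ 2 / 3 * L)

include hx hs hWx hA in
/-- **THE (1.37)-DEFECT AT A STATE WITH MATCHED LINEAR FRAMES IS QUADRATIC.**  Class at `W` (`L ≥ 2`, `LevelSmall d L k x`, `SmallField W x`, `curvSum ≤ 2L∕3`) AND B7's
Prop-4 regime at level `k+1` (`pdev W < α₀·M⁻²`, the displayed numerical lines); a state `u` with `sup‖X(u)‖ ≤ b`, `sup‖N(u)‖ ≤ sN` and MATCHED LINEAR FRAMES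
`framePotW L (k+1) W T(u) z = h(u) z`.  THEN for every coarse site `z`:
`‖mlog(vcov L W (relPert W X(u)) (k+1) z) − h(u) z‖ ≤ (56(dL)² + 16C₁dL)·(M·b)² + 6dM·sN` (`C₁ = 131072(d+1)²`, `M = L^{k+1}`). [folklore] -/
theorem norm_mlog_vcov_sub_cornerLog_le (u : Site d → (Matrix n n ℂ)ˣ)
    {α₀ b sN : ℝ} (hα : 0 < α₀) (hα3 : C0 d * α₀ ≤ 1 / 3) (hα4 : 4 * α₀ ≤ c2' d L)
    (h52 : pdev W < α₀ * (((L : ℝ) ^ (k + 1))⁻¹) ^ 2) (hb : 0 ≤ b) (hX : ∀ (y : Site d) (κ : Fin d), ‖repLog W U' u y κ‖ ≤ b)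
    (hsmall : Real.exp (4 * (800 * ((d : ℝ) + 1) ^ 2 * ((d : ℝ) + 4)) * α₀)
      * (1 + 8 * (131072 * ((d : ℝ) + 1) ^ 2) * ((L : ℝ) ^ (k + 1) * b)) ≤ 2)
    (hc₃ : 2 * ((L : ℝ) ^ (k + 1) * b) ≤ c3 d L) (h100 : 100 * ((d : ℝ) * L * ((L : ℝ) ^ (k + 1) * b)) ≤ 1)
    (hC16 : 16 * (131072 * ((d : ℝ) + 1) ^ 2) * ((L : ℝ) ^ (k + 1) * b) ≤ 1)
    (hsN : 0 ≤ sN) (hN : ∀ (y : Site d) (μ : Fin d), ‖normalPart hL k hWu hx hs hWx N hθ U' u y μ‖ ≤ sN)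
    (hF : ∀ z, framePotW L (k + 1) W (tangentPart hL k hWu hx hs hWx N hθ U' u) z = cornerLog L k u z) (z : Site d) :
    ‖mlog ((vcov L W (relPert W (repLog W U' u)) (k + 1) z : (Matrix n n ℂ)ˣ) : Matrix n n ℂ) - cornerLog L k u z‖
      ≤ (56 * ((d : ℝ) * L) ^ 2 + 16 * (131072 * ((d : ℝ) + 1) ^ 2) * ((d : ℝ) * L)) * ((L : ℝ) ^ (k + 1) * b) ^ 2
        + 6 * (d : ℝ) * (L : ℝ) ^ (k + 1) * sN := by
  -- (i) nonlinear vs linear accumulated frame of X(u)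
  have h1 := norm_mlog_vcov_sub_framePotW_le hL (k + 1) hWu hα hα3 hα4 h52 hb hX hsmall hc₃ h100 hC16 z
  -- (ii) framePotW X − framePotW T = framePotW N, sized by the sup letter
  have hT : framePotW L (k + 1) W (tangentPart hL k hWu hx hs hWx N hθ U' u) z
      = framePotW L (k + 1) W (repLog W U' u) z - framePotW L (k + 1) W (normalPart hL k hWu hx hs hWx N hθ U' u) z :=
    framePotW_sub hL k hWu hx hs hWx (repLog W U' u) (normalPart hL k hWu hx hs hWx N hθ U' u) z
  have h2 : ‖framePotW L (k + 1) W (normalPart hL k hWu hx hs hWx N hθ U' u) z‖ ≤ 6 * (d : ℝ) * (L : ℝ) ^ (k + 1) * sN :=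
    norm_framePotW_le_sup hL k hWu hx hs hWx hsN hN hA z
  -- (iii) three-term identity, the last term vanishing by the matched linear frames
  have e : mlog ((vcov L W (relPert W (repLog W U' u)) (k + 1) z : (Matrix n n ℂ)ˣ) : Matrix n n ℂ) - cornerLog L k u z
      = (mlog ((vcov L W (relPert W (repLog W U' u)) (k + 1) z : (Matrix n n ℂ)ˣ) : Matrix n n ℂ) - framePotW L (k + 1) W (repLog W U' u) z)
        + framePotW L (k + 1) W (normalPart hL k hWu hx hs hWx N hθ U' u) z := by
    rw [← hF z, hT]; abel
  rw [e]
  exact (norm_add_le _ _).trans (add_le_add h1 h2)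

end State

/-! ## §2 The letter at the (S1) limit — one-call binder shape -/

section Limit

open NE3RightInverseSupLetters (supC)

variable {L : ℕ} (hL : 2 ≤ L) (k : ℕ) {W : Site d → Fin d → (Matrix n n ℂ)ˣ} {x : ℝ} (hWu : IsUnitaryCfg W) (hx : 0 ≤ x) (hs : LevelSmall d L k x)
  (hWx : SmallField W x) (N : ℕ) [NeZero N] (hθ : cruxC d L * (((L : ℝ) ^ (k + 1)) ^ 2 * x) < 1) (U' : Site d → Fin d → (Matrix n n ℂ)ˣ)
  (hWP : IsPeriodicCfg W ((tower L N (k + 1) : ℕ) : ℤ)) (hU'u : IsUnitaryCfg U') (hU'P : IsPeriodicCfg U' ((tower L N (k + 1) : ℕ) : ℤ))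
  (hε : ((L : ℝ) ^ (k + 1)) ^ 2 * x ≤ 1) (hA : curvSum d L (k + 1) x ≤ 2 / 3 * L)

include hWP hU'u hU'P hε hA in
/-- **THE (1.37)-DEFECT OF THE (S1) LIMIT IS QUADRATIC** — one call from the data `slice_orbit(_w)` delivers (per-`j` working-region facts, unitary `(tower)`-periodic sitewise
limit `u⋆`, geometric rate, `Df(u j) ≤ ϑ^j·δ₀`) plus the Prop-4 regime at level `k+1` and the two sizes of the limit (`sup‖X(u⋆)‖ ≤ b`, `sup‖N(u⋆)‖ ≤ sN`):
`‖mlog(vcov L W (relPert W X(u⋆)) (k+1) z) − h(u⋆) z‖ ≤ (56(dL)² + 16C₁dL)·(M·b)² + 6dM·sN`.  The matched linear frames of `u⋆` come from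
`NE7SliceFrameMatchingLimit.frameMismatch_limit_eq_zero`. [folklore] -/
theorem norm_mlog_vcov_sub_cornerLog_limit_le (u : ℕ → Site d → (Matrix n n ℂ)ˣ) (ulim : Site d → (Matrix n n ℂ)ˣ)
    (hu : ∀ j, IsUnitarySite (u j)) (huP : ∀ j, IsPeriodicSite (u j) ((tower L N (k + 1) : ℕ) : ℤ))
    (hgu : ∀ j, gaugeAct (u j) U' = vary W (repLog W U' (u j)) 1) (hXu : ∀ j y κ, ‖repLog W U' (u j) y κ‖ ≤ 1 / 8)
    (hcu : ∀ j z, (((u j) (((L : ℤ) ^ (k + 1)) • z) : (Matrix n n ℂ)ˣ) : Matrix n n ℂ) = exp (cornerLog L k (u j) z)) (hhu : ∀ j z, ‖cornerLog L k (u j) z‖ ≤ 1 / 8)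
    (hl : IsUnitarySite ulim) (hlP : IsPeriodicSite ulim ((tower L N (k + 1) : ℕ) : ℤ))
    (hconv : ∀ y, Tendsto (fun j => (((u j) y : (Matrix n n ℂ)ˣ) : Matrix n n ℂ)) atTop (𝓝 ((ulim y : (Matrix n n ℂ)ˣ) : Matrix n n ℂ)))
    {C ϑ δ₀ : ℝ} (hϑ0 : 0 ≤ ϑ) (hϑ1 : ϑ < 1)
    (hrate : ∀ j y, ‖(((u j) y : (Matrix n n ℂ)ˣ) : Matrix n n ℂ) - (ulim y : (Matrix n n ℂ)ˣ)‖ ≤ C * ϑ ^ j)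
    (hDf : ∀ j, sliceDefect hL k hWu hx hs hWx N hθ U' (u j) ≤ ϑ ^ j * δ₀)
    {α₀ b sN : ℝ} (hα : 0 < α₀) (hα3 : C0 d * α₀ ≤ 1 / 3) (hα4 : 4 * α₀ ≤ c2' d L)
    (h52 : pdev W < α₀ * (((L : ℝ) ^ (k + 1))⁻¹) ^ 2) (hb : 0 ≤ b) (hX : ∀ (y : Site d) (κ : Fin d), ‖repLog W U' ulim y κ‖ ≤ b)
    (hsmall : Real.exp (4 * (800 * ((d : ℝ) + 1) ^ 2 * ((d : ℝ) + 4)) * α₀)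
      * (1 + 8 * (131072 * ((d : ℝ) + 1) ^ 2) * ((L : ℝ) ^ (k + 1) * b)) ≤ 2)
    (hc₃ : 2 * ((L : ℝ) ^ (k + 1) * b) ≤ c3 d L) (h100 : 100 * ((d : ℝ) * L * ((L : ℝ) ^ (k + 1) * b)) ≤ 1)
    (hC16 : 16 * (131072 * ((d : ℝ) + 1) ^ 2) * ((L : ℝ) ^ (k + 1) * b) ≤ 1)
    (hsN : 0 ≤ sN) (hN : ∀ (y : Site d) (μ : Fin d), ‖normalPart hL k hWu hx hs hWx N hθ U' ulim y μ‖ ≤ sN) (z : Site d) :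
    ‖mlog ((vcov L W (relPert W (repLog W U' ulim)) (k + 1) z : (Matrix n n ℂ)ˣ) : Matrix n n ℂ) - cornerLog L k ulim z‖
      ≤ (56 * ((d : ℝ) * L) ^ 2 + 16 * (131072 * ((d : ℝ) + 1) ^ 2) * ((d : ℝ) * L)) * ((L : ℝ) ^ (k + 1) * b) ^ 2
        + 6 * (d : ℝ) * (L : ℝ) ^ (k + 1) * sN :=
  norm_mlog_vcov_sub_cornerLog_le hL k hWu hx hs hWx N hθ U' hA ulim hα hα3 hα4 h52 hb hX hsmall hc₃ h100 hC16 hsN hN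
    (frameMismatch_limit_eq_zero hL k hWu hx hs hWx N hθ U' hWP hU'u hU'P hε hA u ulim hu huP hgu hXu hcu hhu hl hlP hconv hϑ0 hϑ1 hrate hDf) z

end Limit

end

end Summit.QuantumFields.BalabanUV.T4Continuum.NE7SliceNonlinearFrameDefect
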